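import Summits.AnomalousDissipation.AnomalousDissipation.Theorems.TaylorWaveQuasiSteady.Negative.LoadBearing
import Literature.Analysis.FunctionSpaces.TorusEnstrophyOrthogonality

/-!
# `NeutralTaylorWaves.TaylorWaveQuasiSteady` (stmt-AnomalousDissipation-16293): three-dimensionality is load-bearing

Negative lemmas (crux disprover, 2026-08-17) for the construction crux

`TaylorWaveQuasiSteady`: ONE smooth divergence-free mean-zero force `f` on `T³`, `ν_n → 0⁺`, `E`,
`ε₀ > 0`; `∀ K ∃ C ∀ n`: smooth divergence-free mean-zero `w`, smooth `q`, drift `|c| ≤ C` with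
`∫‖w‖² ≤ E` (light), `|ν_n‖∇w‖₂² − ε₀| ≤ C√ν_n` (loud), `‖(w·∇)w − ν_nΔw + ∇q − c∂₂w − f‖₂² ≤ C ν_n^K`.

Sequel of `Negative/LoadBearing.lean` (the Euler nonlinearity and the force are load-bearing). Here the
ENSTROPHY balance of a steady quasi-solution is written with the nonlinearity kept:

* `dissipation_bound_with_stretching` — for the FULL residual `R` and every `s ≥ 0`, `ν ≥ 0`,
  `2s·ν‖∇w‖₂² ≤ ‖R‖₂² + ν‖Δf‖₂² + (ν + s²)‖w‖₂² + 2ν ∫⟪(w·∇)w, Δw⟫`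
  (enstrophy identity `ν‖Δw‖₂² = ∫⟪(w·∇)w, Δw⟫ − ∫⟪R, Δw⟫ − ∫⟪Δf, w⟫`, Young twice, and
  `ν‖∇w‖₂² = ∫⟪−νΔw, w⟫`);
* `stretching_floor` — the quantitative NECESSARY CONDITION on every witness: with `s = ε/E`,
  `ε²/E ≤ ‖R‖₂² + ν‖Δf‖₂² + νE + 2ν ∫⟪(w·∇)w, Δw⟫` whenever `ε ≤ ν‖∇w‖₂²`, `∫‖w‖² ≤ E`; along a
  witness family (`‖R_n‖₂² ≤ Cν_n`, `ν_n‖∇w_n‖² ≥ ε₀ − C√ν_n`) the periodic vortex-stretching /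
  enstrophy-production integral must obey `ν_n ∫⟪(w_n·∇)w_n, Δw_n⟫ ≥ ε₀²/(2E) − o(1)`, i.e.
  `∫⟪(w_n·∇)w_n, Δw_n⟫ → +∞` like `ν_n⁻¹`;
* `integral_inner_convect_laplacian_eq_zero_of_planar` — for a PLANAR field on `T³` (no component and
  no dependence along some axis `a`: `w_a ≡ 0`, `∂_a w ≡ 0`) the production vanishes identically
  (the cubic density `∑ₘ∑ᵢ (∂ₘw)ᵢ⟪∂ₘw, ∂ᵢw⟫` of `Torus.integral_inner_laplacian_convect_self_eq_neg` is
  `tr M · (|M|² − det M) = 0` for the traceless `2 × 2` block `M` of `∇w`; FMRT 2001 (A.62) lifted to `T³`);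
* `taylorWaveQuasiSteady_false_planar` — hence the crux with the witnesses additionally required to be
  planar (axis allowed to depend on `K`, `n`) is FALSE already at order `K = 1`: the two-dimensional
  (Alexakis–Doering-type) obstruction, for QUASI-steady families with drift. Any proof of the crux must
  use genuinely three-dimensional fields for all large `n` — in the route's design the oblique wave
  (`m ≠ 0`) on a planar base.

Companion file `Negative/WorkCeiling.lean`: `ε₀² ≤ E·‖f‖₂²`. Not settled here (recorded in the crux work
file `Cruxes/TaylorWaveQuasiSteady/Disproof.lean`): the "two-and-a-half-dimensional" strengthening
(`∂_a w ≡ 0` but `w_a ≢ 0`), where the production reduces to the stretching of the passive component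
`w_a` by the planar strain and does not vanish identically.
-/

-- `Summit.<Summit>.<Problem>` is the tree's mandated summit-side namespace (CONVENTIONS §2); for this
-- single-conjunct summit the two coincide, so the duplicate is deliberate.
set_option linter.dupNamespace false

noncomputable section

open MeasureTheory Filter Topology
open scoped InnerProductSpace

namespace Summit.AnomalousDissipation.AnomalousDissipation.Theorems.TaylorWaveQuasiSteady.Negative

open Literature.Analysis.FunctionSpaces

variable {d : Type*} [Fintype d] [DecidableEq d]

/-! ## The enstrophy balance with the nonlinearity kept -/

section Stretching

variable {w f : UnitAddTorus d → EuclideanSpace ℝ d} {q : UnitAddTorus d → ℝ}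

/-- **Dissipation bound with stretching.** For smooth divergence-free `w`, smooth `q`, `f`, `ν ≥ 0`,
`s ≥ 0` and the FULL steady residual `R = (w·∇)w − νΔw + ∇q − c∂ᵢw − f`:
`2s·ν‖∇w‖₂² ≤ ‖R‖₂² + ν‖Δf‖₂² + ν‖w‖₂² + s²‖w‖₂² + 2ν∫⟪(w·∇)w, Δw⟫`. [folklore] -/
theorem dissipation_bound_with_stretching (hw : Torus.IsSmooth w) (hq : Torus.IsSmooth q)
    (hf : Torus.IsSmooth f) (hdiv : Torus.IsDivFree w) {ν : ℝ} (hν : 0 ≤ ν) (c : ℝ) (i : d)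
    {s : ℝ} (hs : 0 ≤ s) :
    2 * s * (ν * Torus.gradNormSq w) ≤
      (∫ x, ‖Torus.convect w w x - ν • Torus.laplacian w x + Torus.gradient q x
          - c • Torus.partialDeriv i w x - f x‖ ^ 2)
        + ν * (∫ x, ‖Torus.laplacian f x‖ ^ 2) + ν * (∫ x, ‖w x‖ ^ 2)
        + s ^ 2 * (∫ x, ‖w x‖ ^ 2)
        + 2 * ν * ∫ x, ⟪Torus.convect w w x, Torus.laplacian w x⟫_ℝ := by
  set R : UnitAddTorus d → EuclideanSpace ℝ d := fun x =>
    Torus.convect w w x - ν • Torus.laplacian w x + Torus.gradient q x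
      - c • Torus.partialDeriv i w x - f x
  set R₀ : UnitAddTorus d → EuclideanSpace ℝ d := fun x =>
    -(ν • Torus.laplacian w x) + Torus.gradient q x - c • Torus.partialDeriv i w x - f x
  have hRs : Torus.IsSmooth R :=
    ((((hw.convect hw).sub (hw.laplacian.smul ν)).add hq.gradient).sub
      ((hw.partialDeriv i).smul c)).sub hf
  have hR₀s : Torus.IsSmooth R₀ :=
    ((((hw.laplacian.smul ν).neg).add hq.gradient).sub ((hw.partialDeriv i).smul c)).sub hf
  have hL := hw.laplacian
  have hN := hw.convect hw
  -- (A) the linear enstrophy identity, and the splitting `R₀ = R − (w·∇)w`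
  have hid : ν * ∫ x, ‖Torus.laplacian w x‖ ^ 2 =
      -(∫ x, ⟪R₀ x, Torus.laplacian w x⟫_ℝ) - ∫ x, ⟪Torus.laplacian f x, w x⟫_ℝ :=
    linear_enstrophy_identity hw hq hf hdiv ν c i
  have hsplit : ∫ x, ⟪R₀ x, Torus.laplacian w x⟫_ℝ =
      (∫ x, ⟪R x, Torus.laplacian w x⟫_ℝ) - ∫ x, ⟪Torus.convect w w x, Torus.laplacian w x⟫_ℝ := by
    rw [← integral_sub (hRs.inner hL).integrable (hN.inner hL).integrable]
    refine integral_congr_ae (ae_of_all _ fun x => ?_)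
    have hx : R₀ x = R x - Torus.convect w w x := by
      simp only [R, R₀]
      abel
    dsimp only
    rw [hx, inner_sub_left]
  -- (B) Young: `-2ν⟪R, Δw⟫ ≤ ‖R‖² + ν²‖Δw‖²` and `-2ν⟪Δf, w⟫ ≤ ν(‖Δf‖² + ‖w‖²)`
  have hB1 : ∀ x, -(2 * ν * ⟪R x, Torus.laplacian w x⟫_ℝ) ≤
      ‖R x‖ ^ 2 + ν ^ 2 * ‖Torus.laplacian w x‖ ^ 2 := by
    intro x
    have h := two_mul_mul_inner_le (R x) (-Torus.laplacian w x) hν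
    rw [inner_neg_right, norm_neg] at h
    linarith
  have hB2 : ∀ x, -(2 * ν * ⟪Torus.laplacian f x, w x⟫_ℝ) ≤
      ν * ‖Torus.laplacian f x‖ ^ 2 + ν * ‖w x‖ ^ 2 := by
    intro x
    have h := two_mul_mul_inner_le (Torus.laplacian f x) (-w x) zero_le_one
    rw [inner_neg_right, norm_neg] at h
    nlinarith [h, hν]
  have iB1l : Integrable (fun x => -(2 * ν * ⟪R x, Torus.laplacian w x⟫_ℝ)) volume :=
    (((hRs.inner hL).integrable).const_mul (2 * ν)).neg
  have iB1r : Integrable (fun x => ‖R x‖ ^ 2 + ν ^ 2 * ‖Torus.laplacian w x‖ ^ 2) volume :=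
    hRs.norm_sq.integrable.add (hL.norm_sq.integrable.const_mul _)
  have iB2l : Integrable (fun x => -(2 * ν * ⟪Torus.laplacian f x, w x⟫_ℝ)) volume :=
    (((hf.laplacian.inner hw).integrable).const_mul (2 * ν)).neg
  have iB2r : Integrable (fun x => ν * ‖Torus.laplacian f x‖ ^ 2 + ν * ‖w x‖ ^ 2) volume :=
    (hf.laplacian.norm_sq.integrable.const_mul _).add (hw.norm_sq.integrable.const_mul _)
  have hm1 := integral_mono iB1l iB1r hB1
  have hm2 := integral_mono iB2l iB2r hB2
  rw [integral_neg, integral_const_mul,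
    integral_add hRs.norm_sq.integrable (hL.norm_sq.integrable.const_mul _),
    integral_const_mul] at hm1
  rw [integral_neg, integral_const_mul,
    integral_add (hf.laplacian.norm_sq.integrable.const_mul _) (hw.norm_sq.integrable.const_mul _),
    integral_const_mul, integral_const_mul] at hm2
  -- hence `ν²‖Δw‖² ≤ ‖R‖² + ν‖Δf‖² + ν‖w‖² + 2ν ∫⟪(w·∇)w, Δw⟫`
  have hBB : ν ^ 2 * ∫ x, ‖Torus.laplacian w x‖ ^ 2 ≤
      (∫ x, ‖R x‖ ^ 2) + ν * (∫ x, ‖Torus.laplacian f x‖ ^ 2) + ν * (∫ x, ‖w x‖ ^ 2)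
        + 2 * ν * ∫ x, ⟪Torus.convect w w x, Torus.laplacian w x⟫_ℝ := by
    rw [hsplit] at hid
    nlinarith [hid, hm1, hm2]
  -- (C) Young: `2s⟪-νΔw, w⟫ ≤ ν²‖Δw‖² + s²‖w‖²`, and `∫⟪-νΔw, w⟫ = ν‖∇w‖²`
  have hC : ∀ x, 2 * s * ⟪-(ν • Torus.laplacian w x), w x⟫_ℝ ≤
      ν ^ 2 * ‖Torus.laplacian w x‖ ^ 2 + s ^ 2 * ‖w x‖ ^ 2 := by
    intro x
    have h := two_mul_mul_inner_le (-(ν • Torus.laplacian w x)) (w x) hs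
    rw [norm_neg, norm_smul, mul_pow, Real.norm_eq_abs, sq_abs] at h
    exact h
  have iCl : Integrable (fun x => 2 * s * ⟪-(ν • Torus.laplacian w x), w x⟫_ℝ) volume :=
    (((hL.smul ν).neg.inner hw).integrable).const_mul (2 * s)
  have iCr : Integrable (fun x => ν ^ 2 * ‖Torus.laplacian w x‖ ^ 2 + s ^ 2 * ‖w x‖ ^ 2) volume :=
    (hL.norm_sq.integrable.const_mul _).add (hw.norm_sq.integrable.const_mul _)
  have hm3 := integral_mono iCl iCr hC
  rw [integral_const_mul,
    integral_add (hL.norm_sq.integrable.const_mul _) (hw.norm_sq.integrable.const_mul _),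
    integral_const_mul, integral_const_mul] at hm3
  have eC : ∫ x, ⟪-(ν • Torus.laplacian w x), w x⟫_ℝ = ν * Torus.gradNormSq w := by
    simp_rw [inner_neg_left, real_inner_smul_left]
    rw [integral_neg, integral_const_mul]
    rw [Torus.integral_inner_laplacian_self_eq_neg_gradNormSq_of_isSmooth hw]
    ring
  rw [eC] at hm3
  linarith

/-- **Enstrophy-production floor** (necessary condition on every witness of the crux). For smooth
divergence-free `w`, smooth `q`, `f`, viscosity `ν ≥ 0`, drift `c`, energy `∫‖w‖² ≤ E` with `E > 0`
and dissipation `ν‖∇w‖₂² ≥ ε ≥ 0`: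
`ε²/E ≤ ‖R‖₂² + ν‖Δf‖₂² + νE + 2ν∫⟪(w·∇)w, Δw⟫` (`R` the full steady residual). Along a witness
family of `TaylorWaveQuasiSteady` (`‖R_n‖₂² ≤ Cν_n`, `ε = ε₀ − C√ν_n`) this reads
`ν_n∫⟪(w_n·∇)w_n, Δw_n⟫ ≥ ε₀²/(2E) − o(1)`: the periodic vortex stretching must produce enstrophy at
rate `≳ ν_n⁻¹`. [folklore] -/
theorem stretching_floor (hw : Torus.IsSmooth w) (hq : Torus.IsSmooth q) (hf : Torus.IsSmooth f)
    (hdiv : Torus.IsDivFree w) {ν : ℝ} (hν : 0 ≤ ν) (c : ℝ) (i : d) {E ε : ℝ} (hE : 0 < E)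
    (hε : 0 ≤ ε) (hwE : ∫ x, ‖w x‖ ^ 2 ≤ E) (hεw : ε ≤ ν * Torus.gradNormSq w) :
    ε ^ 2 / E ≤
      (∫ x, ‖Torus.convect w w x - ν • Torus.laplacian w x + Torus.gradient q x
          - c • Torus.partialDeriv i w x - f x‖ ^ 2)
        + ν * (∫ x, ‖Torus.laplacian f x‖ ^ 2) + ν * E
        + 2 * ν * ∫ x, ⟪Torus.convect w w x, Torus.laplacian w x⟫_ℝ := by
  have hs : 0 ≤ ε / E := div_nonneg hε hE.le
  have h := dissipation_bound_with_stretching hw hq hf hdiv hν c i hs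
  have hE' : 0 ≤ ∫ x, ‖w x‖ ^ 2 := integral_nonneg fun x => by positivity
  have h1 : 2 * (ε / E) * ε ≤ 2 * (ε / E) * (ν * Torus.gradNormSq w) :=
    mul_le_mul_of_nonneg_left hεw (by positivity)
  have h2 : (ε / E) ^ 2 * (∫ x, ‖w x‖ ^ 2) ≤ (ε / E) ^ 2 * E :=
    mul_le_mul_of_nonneg_left hwE (sq_nonneg _)
  have h3 : ν * (∫ x, ‖w x‖ ^ 2) ≤ ν * E := mul_le_mul_of_nonneg_left hwE hν
  have key : 2 * (ε / E) * ε - (ε / E) ^ 2 * E = ε ^ 2 / E := by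
    field_simp
    ring
  linarith [key]

end Stretching

/-! ## Planar fields produce no enstrophy -/

section Planar

/-- **The cubic density vanishes on planar Jacobians.** For rows `R : Fin 3 → ℝ³` of a `3 × 3` matrix
with a zero row `R a = 0`, a zero column `(R m) a = 0` and zero trace, `∑ₘ∑ᵢ (Rₘ)ᵢ⟪Rₘ, Rᵢ⟫ = 0`: the
density is `tr(Mᵀ M Mᵀ) = tr M · (|M|² − det M)` for the remaining `2 × 2` block `M` (Cayley–Hamilton),
cf. `Torus.sum_apply_mul_inner_eq_zero_of_fin_two`. [folklore] -/
theorem sum_apply_mul_inner_eq_zero_of_planar (R : Fin 3 → EuclideanSpace ℝ (Fin 3)) (a : Fin 3)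
    (hrow : R a = 0) (hcol : ∀ m, R m a = 0) (htr : ∑ m, R m m = 0) :
    ∑ m, ∑ i, R m i * ⟪R m, R i⟫_ℝ = 0 := by
  have hr : ∀ i, R a i = 0 := fun i => by simp [hrow]
  have hc0 := hcol 0
  have hc1 := hcol 1
  have hc2 := hcol 2
  have hr0 := hr 0
  have hr1 := hr 1
  have hr2 := hr 2
  simp only [Fin.sum_univ_three] at htr
  fin_cases a
  · simp only [Fin.zero_eta, Fin.isValue] at hc0 hc1 hc2 hr0 hr1 hr2
    have h22 : R 2 2 = -R 1 1 := by linarith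
    simp only [Fin.sum_univ_three, EuclideanSpace.inner_eq_star_dotProduct, star_trivial,
      dotProduct, Fin.isValue, hc1, hc2, hr0, hr1, hr2, h22]
    ring
  · simp only [Fin.mk_one, Fin.isValue] at hc0 hc1 hc2 hr0 hr1 hr2
    have h22 : R 2 2 = -R 0 0 := by linarith
    simp only [Fin.sum_univ_three, EuclideanSpace.inner_eq_star_dotProduct, star_trivial,
      dotProduct, Fin.isValue, hc0, hc2, hr0, hr1, hr2, h22]
    ring
  · simp only [Fin.reduceFinMk, Fin.isValue] at hc0 hc1 hc2 hr0 hr1 hr2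
    have h11 : R 1 1 = -R 0 0 := by linarith
    simp only [Fin.sum_univ_three, EuclideanSpace.inner_eq_star_dotProduct, star_trivial,
      dotProduct, Fin.isValue, hc0, hc1, hr0, hr1, hr2, h11]
    ring

-- PLANAR with respect to the axis `a` means: no component and no variation along `a`,
-- `∀ x, w x a = 0` and `∀ x, Torus.partialDeriv a w x = 0` (a two-dimensional two-component field
-- lifted to `T³`); the two hypotheses are carried explicitly (no auxiliary definition).

/-- The cubic (vortex-stretching) density of a smooth divergence-free planar field on `T³` vanishes
pointwise. [folklore] -/
theorem sum_partialDeriv_mul_inner_eq_zero_of_planar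
    {w : UnitAddTorus (Fin 3) → EuclideanSpace ℝ (Fin 3)} (hw : Torus.IsSmooth w)
    (hdiv : Torus.IsDivFree w) {a : Fin 3} (hwa : ∀ x, w x a = 0)
    (hinv : ∀ x, Torus.partialDeriv a w x = 0) (x : UnitAddTorus (Fin 3)) :
    ∑ m, ∑ i, Torus.partialDeriv m w x i *
      ⟪Torus.partialDeriv m w x, Torus.partialDeriv i w x⟫_ℝ = 0 := by
  have hw1 : Torus.IsContDiff 1 w := hw.isContDiff (by simp)
  refine sum_apply_mul_inner_eq_zero_of_planar (fun m => Torus.partialDeriv m w x) a (hinv x) ?_ ?_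
  · intro m
    show Torus.partialDeriv m w x a = 0
    rw [← Torus.partialDeriv_apply_coord hw1]
    have h0 : (fun y => w y a) = fun _ => (0 : ℝ) := funext hwa
    rw [h0]
    simp [Torus.partialDeriv, Torus.lineDeriv]
  · have h := hdiv x
    rw [Torus.divergence_eq_sum_partialDeriv_apply hw1 x] at h
    exact h

/-- **Planar fields produce no enstrophy on `T³`**: for a smooth divergence-free planar field,
`∫⟪(w·∇)w, Δw⟫ = 0` (FMRT 2001, App. II.A (A.62), through
`Torus.integral_inner_laplacian_convect_self_eq_neg`). [folklore] -/
theorem integral_inner_convect_laplacian_eq_zero_of_planar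
    {w : UnitAddTorus (Fin 3) → EuclideanSpace ℝ (Fin 3)} (hw : Torus.IsSmooth w)
    (hdiv : Torus.IsDivFree w) {a : Fin 3} (hwa : ∀ x, w x a = 0)
    (hinv : ∀ x, Torus.partialDeriv a w x = 0) :
    ∫ x, ⟪Torus.convect w w x, Torus.laplacian w x⟫_ℝ = 0 := by
  have h := Torus.integral_inner_laplacian_convect_self_eq_neg hw hdiv
  simp_rw [sum_partialDeriv_mul_inner_eq_zero_of_planar hw hdiv hwa hinv] at h
  rw [integral_zero, neg_zero] at h
  rw [← h]
  exact integral_congr_ae (ae_of_all _ fun x => real_inner_comm _ _)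

/-- For planar fields the dissipation bound holds WITHOUT the stretching term:
`2s·ν‖∇w‖₂² ≤ ‖R‖₂² + ν‖Δf‖₂² + ν‖w‖₂² + s²‖w‖₂²` for the full residual `R`. [folklore] -/
theorem planar_dissipation_bound {w f : UnitAddTorus (Fin 3) → EuclideanSpace ℝ (Fin 3)}
    {q : UnitAddTorus (Fin 3) → ℝ} (hw : Torus.IsSmooth w) (hq : Torus.IsSmooth q)
    (hf : Torus.IsSmooth f) (hdiv : Torus.IsDivFree w) {a : Fin 3} (hwa : ∀ x, w x a = 0)
    (hinv : ∀ x, Torus.partialDeriv a w x = 0) {ν : ℝ} (hν : 0 ≤ ν) (c : ℝ) (i : Fin 3) {s : ℝ}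
    (hs : 0 ≤ s) :
    2 * s * (ν * Torus.gradNormSq w) ≤
      (∫ x, ‖Torus.convect w w x - ν • Torus.laplacian w x + Torus.gradient q x
          - c • Torus.partialDeriv i w x - f x‖ ^ 2)
        + ν * (∫ x, ‖Torus.laplacian f x‖ ^ 2) + ν * (∫ x, ‖w x‖ ^ 2)
        + s ^ 2 * (∫ x, ‖w x‖ ^ 2) := by
  have h := dissipation_bound_with_stretching hw hq hf hdiv hν c i hs
  rw [integral_inner_convect_laplacian_eq_zero_of_planar hw hdiv hwa hinv, mul_zero, add_zero] at h
  exact h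

end Planar

/-! ## The negative lemmas -/

/-- **Three-dimensionality is load-bearing** [negative lemma for `NeutralTaylorWaves.TaylorWaveQuasiSteady`,
stmt-AnomalousDissipation-16293; refutes the natural PLANAR strengthening]: there is NO fixed-force,
light, loud, quasi-steady family whose members are planar (`w_a ≡ 0`, `∂_a w ≡ 0` for some axis `a`,
allowed to vary with `K` and `n`) — already the order `K = 1` is contradictory. Proof:
`planar_dissipation_bound` with `s = √ν_n` gives `2ν_n‖∇w_n‖² ≤ √ν_n (C + ‖Δf‖₂² + 2E)` against
`ν_n‖∇w_n‖² ≥ ε₀ − C√ν_n`. (Two-dimensional steady quasi-solutions cannot dissipate anomalously: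
the enstrophy cannot be produced; cf. the barrier `Literature.Barriers.AnomalousDissipation.
AlexakisDoering2006_energyDissipationBound` for genuine 2-D flows.) [folklore] -/
theorem taylorWaveQuasiSteady_false_planar :
    ¬ ∃ f : UnitAddTorus (Fin 3) → EuclideanSpace ℝ (Fin 3),
      Torus.IsSmooth f ∧ Torus.IsDivFree f ∧ Torus.HasZeroMean f ∧
      ∃ (ν : ℕ → ℝ) (E ε₀ : ℝ), (∀ n, 0 < ν n) ∧ Filter.Tendsto ν Filter.atTop (nhds 0) ∧ 0 < ε₀ ∧
      ∀ K : ℕ, ∃ C : ℝ, ∀ n : ℕ, ∃ (w : UnitAddTorus (Fin 3) → EuclideanSpace ℝ (Fin 3))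
        (q : UnitAddTorus (Fin 3) → ℝ) (c : ℝ),
        (∃ a : Fin 3, (∀ x, w x a = 0) ∧ ∀ x, Torus.partialDeriv a w x = 0) ∧
        Torus.IsSmooth w ∧ Torus.IsSmooth q ∧ Torus.IsDivFree w ∧ Torus.HasZeroMean w ∧ |c| ≤ C ∧
        MeasureTheory.integral MeasureTheory.volume (fun x => ‖w x‖ ^ 2) ≤ E ∧
        |ν n * Torus.gradNormSq w - ε₀| ≤ C * Real.sqrt (ν n) ∧
        MeasureTheory.integral MeasureTheory.volume (fun x =>
          ‖Torus.convect w w x - (ν n) • Torus.laplacian w x + Torus.gradient q x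
            - c • Torus.partialDeriv (2 : Fin 3) w x - f x‖ ^ 2) ≤ C * (ν n) ^ (K : ℕ) := by
  rintro ⟨f, hf, -, -, ν, E, ε₀, hν, hν0, hε₀, hK⟩
  obtain ⟨C, hC⟩ := hK 1
  set F₂ : ℝ := ∫ x, ‖Torus.laplacian f x‖ ^ 2
  have hF₂0 : 0 ≤ F₂ := integral_nonneg fun x => by positivity
  -- constants are nonnegative (from `n = 0`)
  obtain ⟨w₀, q₀, c₀, -, -, -, -, -, hc₀, hE₀, -, -⟩ := hC 0
  have hC0 : 0 ≤ C := (abs_nonneg c₀).trans hc₀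
  have hE0 : 0 ≤ E := (integral_nonneg fun x => by positivity).trans hE₀
  -- choose `n` with `√ν_n < δ`
  set M : ℝ := 3 * C + F₂ + 2 * E + 1 with hM
  have hMpos : 0 < M := by rw [hM]; linarith
  obtain ⟨δ, hδ, hδM⟩ : ∃ δ : ℝ, 0 < δ ∧ δ * M < 2 * ε₀ :=
    ⟨ε₀ / M, div_pos hε₀ hMpos, by rw [div_mul_cancel₀ _ hMpos.ne']; linarith⟩
  obtain ⟨n, hn⟩ : ∃ n, ν n < δ ^ 2 :=
    (hν0.eventually (gt_mem_nhds (by positivity))).exists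
  obtain ⟨w, q, c, ⟨a, hwa, hinv⟩, hw, hq, hdiv, -, -, hEn, hDn, hRn⟩ := hC n
  set r : ℝ := Real.sqrt (ν n)
  have hr0 : 0 ≤ r := Real.sqrt_nonneg _
  have hrr : r ^ 2 = ν n := Real.sq_sqrt (hν n).le
  have hrδ : r < δ := (Real.sqrt_lt' hδ).2 hn
  -- the planar dissipation bound with `s = r`
  have hB := planar_dissipation_bound hw hq hf hdiv hwa hinv (hν n).le c (2 : Fin 3) hr0
  have hE' : 0 ≤ ∫ x, ‖w x‖ ^ 2 := integral_nonneg fun x => by positivity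
  rw [pow_one] at hRn
  -- `2 r (ν G) ≤ r² (C + F₂ + 2E)`
  have h1 : 2 * r * (ν n * Torus.gradNormSq w) ≤ r ^ 2 * (C + F₂ + 2 * E) := by
    rw [hrr]
    nlinarith [hB, hRn, hEn, hE', (hν n).le, hF₂0, mul_le_mul_of_nonneg_left hEn (hν n).le,
      mul_le_mul_of_nonneg_left hEn (sq_nonneg r)]
  -- dissipation clause: `ε₀ ≤ ν G + C r`
  have h2 : ε₀ ≤ ν n * Torus.gradNormSq w + C * r := by
    have := (abs_le.1 hDn).1
    linarith
  have hrpos : 0 < r := Real.sqrt_pos.2 (hν n)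
  have h3 : 2 * (ν n * Torus.gradNormSq w) ≤ r * (C + F₂ + 2 * E) := by
    have := h1
    nlinarith [this, hrpos]
  have h4 : 2 * ε₀ ≤ r * M := by rw [hM]; nlinarith [h2, h3, hC0, hr0]
  have h5 : r * M < 2 * ε₀ := by nlinarith [hrδ, hMpos, hr0, hδM]
  linarith

end Summit.AnomalousDissipation.AnomalousDissipation.Theorems.TaylorWaveQuasiSteady.Negative

end
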